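import Literature.NumberTheory.GelbartRogawski1991.UnitaryDualPairSeesawConjCharacter
import Literature.NumberTheory.Automorphic.UnitaryGroupSeesawConjugationLeft
import Literature.NumberTheory.Weil1964.AdelicMetaplecticRationalLiftConj
import HarnessLib

/-!
# Transport of a compatible splitting of a unitary dual pair along a rational isometry of the FIRST member

Topic `NumberTheory/GelbartRogawski1991`; namespace `Literature.NumberTheory.GelbartRogawski1991.UnitaryDualPair` (sequel of
`UnitaryDualPairSeesawConjCharacter`, which treats the see-saw partner on the SECOND member).  Definitions with bodies (homomorphisms)
and proved theorems only: no named facts, no `sorry`.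

SETTING.  The dual pair `U(J_V) × U(J_W)` with `J_V = T_V ⊗ 1`, `J_W = T_W ⊗ 1` over a CM extension `E/F`, a compatible splitting
`s : U(J_V ⊗ J_W)(𝔸_F) →* Mp_ψ(𝕎_{adelicGram e T_V T_W})ᶜᵒⁿᵗ` of its datum of record ([GelbartRogawski1991, Prop. 3.1.1];
`UnitaryDualPairSplittingDatum.splittingDatum`), and a second hermitian structure `J_V′ = T_V′ ⊗ 1` on the first member with an
adelic isometry `a : (V ⊗ 𝔸, J_V′) ≅ (V ⊗ 𝔸, J_V)` which is RATIONAL (`a = a₀ ⊗ 1`, `a₀ ∈ GL_N(E)` a general `E`-point) and a rational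
relabelling `C = C₀ ⊗ 1`, `(T_V ⊗ T_W ⊗ 1) C = T_V′ ⊗ T_W ⊗ 1` (the data of `UnitaryGroupSeesawConjugationLeft.adelicSeesawConjLeft`).

* §1 `adelicPairIsometryConjLeft a ha : U(J_V′ ⊗ J_W)(𝔸) →* U(J_V ⊗ J_W)(𝔸)`, `p′ ↦ (a ⊗ 1) p′ (a ⊗ 1)⁻¹`, its values on the two
  members, rational points to rational points, and the square `adelicSeesawConjLeft_conj_pair` on the WHOLE big group
  (`UnitaryGroupSeesawConjugation.seesawConj_conj_toSymplectic`; `pairToSymplectic` is `toSymplectic` of the Kronecker Gram).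
* §2 `seesawPairConjLeft s a ha := reindex_e⁻¹ ∘ s ∘ adelicPairIsometryConjLeft` (Kronecker coordinates), its projection, `Θ`-fixing at
  rational points; `seesawConjSplittingLeft := ratConjSplitting … h₀ hrat C hC (seesawPairConjLeft …)` — conjugation by Weil's `Θ`-fixing
  rational lift `r_F(h₀)` of the see-saw element `h₀ = adelicSeesawConjLeft a C` and relabelling by `C`
  (`AdelicMetaplecticSeesawConjugate.ratConjSplitting`); `proj_seesawConjSplittingLeft` (the seam lemma fed by the square),
  `coe_seesawConjSplittingLeft_mem_adelicMpTheta`.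
The sequel `UnitaryDualPairTransportedSplittingLeft` reindexes back to the datum of record and proves COMPATIBILITY of the transported
splitting ([GelbartRogawski1991, Prop. 3.1.1], both clauses).  No continuity is claimed (conjugation by the non-pointwise `ω(r_F h₀)`).

## References
* [Kudla1984] S. Kudla, *Seesaw dual reductive pairs*, Progr. Math. 46 (1984) 244–268, §1.
* [GelbartRogawski1991] S. Gelbart, J. Rogawski, Invent. Math. 105 (1991), §3.1 Prop. 3.1.1 p. 455 L1–3, Remark p. 457 L4, p. 454 L40–42.
* [Weil1964] A. Weil, Acta Math. 111 (1964), Chap. III n° 40 p. 190, n° 41 Théorème 6 p. 193.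
* [MoeglinVignerasWaldspurger1987] C. Mœglin, M.-F. Vignéras, J.-L. Waldspurger, LNM 1291 (1987), Chap. 2 II.1.
-/

set_option autoImplicit false

noncomputable section

open scoped Matrix Kronecker
open NumberField
open Literature.RepresentationTheory.HeisenbergGroup
open Literature.RepresentationTheory.HeisenbergGroup.SymplecticMatrix (transportSp mapHom)
open Literature.NumberTheory.Automorphic
open Literature.NumberTheory.Automorphic.UnitaryGroup
open Literature.NumberTheory.Weil1964

namespace Literature.NumberTheory.GelbartRogawski1991

namespace UnitaryDualPair

/-! ## §1 Conjugation by `a ⊗ 1` on the whole big group `U(J_V′ ⊗ J_W)(𝔸)` and the square -/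

section PairConj

variable (F E : Type) [Field F] [NumberField F] [Field E] [NumberField E] [Algebra F E]
variable (c : E ≃ₐ[F] E) (N M : ℕ) {JV JV' : Matrix (Fin N) (Fin N) E} {JW : Matrix (Fin M) (Fin M) E}

/-- **`p′ ↦ (a ⊗ 1) p′ (a ⊗ 1)⁻¹ : U(J_V′ ⊗ J_W)(𝔸_F) →* U(J_V ⊗ J_W)(𝔸_F)`** for an adelic isometry `a : J_V′ → J_V`
(`(c a)ᵀ (J_V ⊗ 1) a = J_V′ ⊗ 1`). [cite: Kudla1984, §1] -/
def adelicPairIsometryConjLeft (a : GL (Fin N) (AdeleRing (𝓞 E) E))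
    (ha : ((a : Matrix (Fin N) (Fin N) (AdeleRing (𝓞 E) E)).map (conjAdele F E c))ᵀ * adelicForm E N JV * a =
      adelicForm E N JV') : adelicPair F E c N M JV' JW →* adelicPair F E c N M JV JW :=
  isometryConj (conjAdele F E c) (kroneckerGL (a, (1 : GL (Fin M) (AdeleRing (𝓞 E) E))))
    (kroneckerGL_isometry_one (conjAdele F E c) a ha (adelicForm E M JW))

omit [NumberField F] in
/-- underlying element: `(a ⊗ 1) p′ (a ⊗ 1)⁻¹`. [cite: Kudla1984, §1] -/
@[simp] theorem coe_adelicPairIsometryConjLeft (a : GL (Fin N) (AdeleRing (𝓞 E) E))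
    (ha : ((a : Matrix (Fin N) (Fin N) (AdeleRing (𝓞 E) E)).map (conjAdele F E c))ᵀ * adelicForm E N JV * a =
      adelicForm E N JV') (p : adelicPair F E c N M JV' JW) :
    ((adelicPairIsometryConjLeft F E c N M a ha p : adelicPair F E c N M JV JW) :
        GL (Fin N × Fin M) (AdeleRing (𝓞 E) E)) =
      kroneckerGL (a, (1 : GL (Fin M) (AdeleRing (𝓞 E) E))) * (p : GL (Fin N × Fin M) (AdeleRing (𝓞 E) E)) *
        (kroneckerGL (a, (1 : GL (Fin M) (AdeleRing (𝓞 E) E))))⁻¹ :=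
  rfl

omit [NumberField F] in
/-- on the first member: `(a ⊗ 1)(v′ ⊗ 1)(a ⊗ 1)⁻¹ = (a v′ a⁻¹) ⊗ 1`. [cite: Kudla1984, §1] -/
theorem adelicPairIsometryConjLeft_adelicInl (a : GL (Fin N) (AdeleRing (𝓞 E) E))
    (ha : ((a : Matrix (Fin N) (Fin N) (AdeleRing (𝓞 E) E)).map (conjAdele F E c))ᵀ * adelicForm E N JV * a =
      adelicForm E N JV') (v : adelic F E c N JV') :
    adelicPairIsometryConjLeft F E c N M a ha (adelicInl F E c N M JV' JW v) =
      adelicInl F E c N M JV JW (adelicIsometryConj F E c N a ha v) :=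
  Subtype.ext (kroneckerGL_conj_one a (v : GL (Fin N) (AdeleRing (𝓞 E) E)) 1)

omit [NumberField F] in
/-- on the second member: `(a ⊗ 1)(1 ⊗ u)(a ⊗ 1)⁻¹ = 1 ⊗ u`. [cite: Kudla1984, §1] -/
theorem adelicPairIsometryConjLeft_adelicInr (a : GL (Fin N) (AdeleRing (𝓞 E) E))
    (ha : ((a : Matrix (Fin N) (Fin N) (AdeleRing (𝓞 E) E)).map (conjAdele F E c))ᵀ * adelicForm E N JV * a =
      adelicForm E N JV') (u : adelic F E c M JW) :
    adelicPairIsometryConjLeft F E c N M a ha (adelicInr F E c N M JV' JW u) = adelicInr F E c N M JV JW u := by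
  refine Subtype.ext ?_
  show kroneckerGL (a, (1 : GL (Fin M) (AdeleRing (𝓞 E) E))) * kroneckerGL ((1 : GL (Fin N) (AdeleRing (𝓞 E) E)), (u : GL (Fin M) (AdeleRing (𝓞 E) E))) *
      (kroneckerGL (a, (1 : GL (Fin M) (AdeleRing (𝓞 E) E))))⁻¹ =
    kroneckerGL ((1 : GL (Fin N) (AdeleRing (𝓞 E) E)), (u : GL (Fin M) (AdeleRing (𝓞 E) E)))
  rw [kroneckerGL_conj_one, mul_one, mul_inv_cancel]

omit [NumberField F] in
/-- **conjugates of rational points are rational**: for a rational isometry `a = a₀ ⊗ 1`,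
`(a ⊗ 1)(γ ⊗ 1)(a ⊗ 1)⁻¹ = ((a₀ ⊗ 1) γ (a₀ ⊗ 1)⁻¹) ⊗ 1`. [cite: GelbartRogawski1991, §3.1 p. 455] -/
theorem adelicPairIsometryConjLeft_rationalPairToAdelic (a : GL (Fin N) (AdeleRing (𝓞 E) E))
    (ha : ((a : Matrix (Fin N) (Fin N) (AdeleRing (𝓞 E) E)).map (conjAdele F E c))ᵀ * adelicForm E N JV * a =
      adelicForm E N JV') (a₀ : GL (Fin N) E)
    (ha₀ : (((a₀ : GL (Fin N) E) : Matrix (Fin N) (Fin N) E).map (c : E →+* E))ᵀ * JV * a₀ = JV')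
    (haa₀ : (a : Matrix (Fin N) (Fin N) (AdeleRing (𝓞 E) E)) =
      ((a₀ : GL (Fin N) E) : Matrix (Fin N) (Fin N) E).map (algebraMap E (AdeleRing (𝓞 E) E)))
    (γ : rationalPair F E c N M JV' JW) :
    adelicPairIsometryConjLeft F E c N M a ha (rationalPairToAdelic F E c N M JV' JW γ) =
      rationalPairToAdelic F E c N M JV JW
        (isometryConj (c : E →+* E) (kroneckerGL (a₀, (1 : GL (Fin M) E)))
          (kroneckerGL_isometry_one (c : E →+* E) a₀ ha₀ JW) γ) := by
  have ham : kroneckerGL (a, (1 : GL (Fin M) (AdeleRing (𝓞 E) E))) =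
      Matrix.GeneralLinearGroup.map (algebraMap E (AdeleRing (𝓞 E) E)) (kroneckerGL (a₀, (1 : GL (Fin M) E))) := by
    refine Units.ext ?_
    show (a : Matrix (Fin N) (Fin N) (AdeleRing (𝓞 E) E)) ⊗ₖ
        ((1 : GL (Fin M) (AdeleRing (𝓞 E) E)) : Matrix (Fin M) (Fin M) (AdeleRing (𝓞 E) E)) =
      (((a₀ : GL (Fin N) E) : Matrix (Fin N) (Fin N) E) ⊗ₖ ((1 : GL (Fin M) E) : Matrix (Fin M) (Fin M) E)).map
        (algebraMap E (AdeleRing (𝓞 E) E))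
    rw [Units.val_one, Units.val_one, haa₀, ← Matrix.map_one (algebraMap E (AdeleRing (𝓞 E) E)) (map_zero _)
      (map_one _), kronecker_map_map]
  have hγ : ((rationalPairToAdelic F E c N M JV' JW γ : adelicPair F E c N M JV' JW) :
      GL (Fin N × Fin M) (AdeleRing (𝓞 E) E)) =
      Matrix.GeneralLinearGroup.map (algebraMap E (AdeleRing (𝓞 E) E)) (γ : GL (Fin N × Fin M) E) :=
    Units.ext (coe_rationalPairToAdelic F E c N M JV' JW γ)
  have hγ' : ((rationalPairToAdelic F E c N M JV JW
        (isometryConj (c : E →+* E) (kroneckerGL (a₀, (1 : GL (Fin M) E)))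
          (kroneckerGL_isometry_one (c : E →+* E) a₀ ha₀ JW) γ) : adelicPair F E c N M JV JW) :
      GL (Fin N × Fin M) (AdeleRing (𝓞 E) E)) =
      Matrix.GeneralLinearGroup.map (algebraMap E (AdeleRing (𝓞 E) E))
        ((isometryConj (c : E →+* E) (kroneckerGL (a₀, (1 : GL (Fin M) E)))
          (kroneckerGL_isometry_one (c : E →+* E) a₀ ha₀ JW) γ : rationalPair F E c N M JV JW) :
          GL (Fin N × Fin M) E) :=
    Units.ext (coe_rationalPairToAdelic F E c N M JV JW _)
  refine Subtype.ext ?_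
  rw [coe_adelicPairIsometryConjLeft, ham, hγ, hγ', coe_isometryConj, map_mul, map_mul, map_inv]

omit [NumberField F] in
/-- … hence `(a ⊗ 1) γ (a ⊗ 1)⁻¹ ∈ G₁(F)` for `γ ∈ G₁′(F)`. [cite: GelbartRogawski1991, §3.1 p. 455] -/
theorem adelicPairIsometryConjLeft_mem_range (a : GL (Fin N) (AdeleRing (𝓞 E) E))
    (ha : ((a : Matrix (Fin N) (Fin N) (AdeleRing (𝓞 E) E)).map (conjAdele F E c))ᵀ * adelicForm E N JV * a =
      adelicForm E N JV') (a₀ : GL (Fin N) E)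
    (ha₀ : (((a₀ : GL (Fin N) E) : Matrix (Fin N) (Fin N) E).map (c : E →+* E))ᵀ * JV * a₀ = JV')
    (haa₀ : (a : Matrix (Fin N) (Fin N) (AdeleRing (𝓞 E) E)) =
      ((a₀ : GL (Fin N) E) : Matrix (Fin N) (Fin N) E).map (algebraMap E (AdeleRing (𝓞 E) E)))
    {p : adelicPair F E c N M JV' JW} (hp : p ∈ (rationalPairToAdelic F E c N M JV' JW).range) :
    adelicPairIsometryConjLeft F E c N M a ha p ∈ (rationalPairToAdelic F E c N M JV JW).range := by
  obtain ⟨γ, rfl⟩ := hp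
  exact ⟨_, (adelicPairIsometryConjLeft_rationalPairToAdelic F E c N M a ha a₀ ha₀ haa₀ γ).symm⟩

variable [Algebra.IsQuadraticExtension F E] {δ : E} (hcδ : c δ = -δ) (hδ : δ ≠ 0) {d : F}
  (hd : δ * δ = algebraMap F E d) {TV TV' : Matrix (Fin N) (Fin N) F} {TW : Matrix (Fin M) (Fin M) F}
  (hV : TV.IsSymm) (hV' : TV'.IsSymm) (hW : TW.IsSymm)
  (hJV : JV = TV.map (algebraMap F E)) (hJV' : JV' = TV'.map (algebraMap F E)) (hJW : JW = TW.map (algebraMap F E))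
  (a : GL (Fin N) (AdeleRing (𝓞 E) E))
  (ha : ((a : Matrix (Fin N) (Fin N) (AdeleRing (𝓞 E) E)).map (conjAdele F E c))ᵀ * adelicForm E N JV * a =
    adelicForm E N JV') (C : GL (Fin N × Fin M) (AdeleRing (𝓞 F) F))
  (hC : TV.map (algebraMap F (AdeleRing (𝓞 F) F)) ⊗ₖ TW.map (algebraMap F (AdeleRing (𝓞 F) F)) *
      (C : Matrix (Fin N × Fin M) (Fin N × Fin M) (AdeleRing (𝓞 F) F)) =
    TV'.map (algebraMap F (AdeleRing (𝓞 F) F)) ⊗ₖ TW.map (algebraMap F (AdeleRing (𝓞 F) F)))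

/-- **THE SQUARE ON THE WHOLE BIG GROUP**: for `p′ ∈ U(J_V′ ⊗ J_W)(𝔸_F)`, `h₀ = adelicSeesawConjLeft a C`:
`h₀ · (Λ_C toSp′(p′) Λ_C⁻¹) · h₀⁻¹ = toSp((a ⊗ 1) p′ (a ⊗ 1)⁻¹)` (`seesawConj_conj_toSymplectic`; `pairToSymplectic` is
`toSymplectic` of the Kronecker Gram). [cite: Kudla1984, §1] -/
theorem adelicSeesawConjLeft_conj_pair (p : adelicPair F E c N M JV' JW) :
    adelicSeesawConjLeft F E c N M hcδ hδ hd hV hV' hW hJV hJV' hJW a ha C hC *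
        symplecticGroupCongr _ _ (relabelEquiv C) (polar_relabelEquiv _ C hC)
          (adelicPairToSymplectic F E c N M hcδ hδ hd hV' hW hJV' hJW p) *
      (adelicSeesawConjLeft F E c N M hcδ hδ hd hV hV' hW hJV hJV' hJW a ha C hC)⁻¹ =
    adelicPairToSymplectic F E c N M hcδ hδ hd hV hW hJV hJW (adelicPairIsometryConjLeft F E c N M a ha p) :=
  (isQuadraticCoordinates_adele E c hcδ hδ hd).seesawConj_conj_toSymplectic (Fin N × Fin M) _ _ _ _ _ _ _ _ C hC p

end PairConj

/-! ## §2 The splitting read through `Ad(a ⊗ 1)`, conjugated by `r_F(h₀)` and relabelled -/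

section Transport

variable (F E : Type) [Field F] [NumberField F] [Field E] [NumberField E] [Algebra F E]
variable (c : E ≃ₐ[F] E) (N M : ℕ) {n : ℕ} (e : Fin N × Fin M ≃ Fin n)
variable (JV JV' : Matrix (Fin N) (Fin N) E) (JW : Matrix (Fin M) (Fin M) E)
variable {TV TV' : Matrix (Fin N) (Fin N) F} {TW : Matrix (Fin M) (Fin M) F}

/-- **The splitting of the `(J_V, J_W)`-datum read on `U(J_V′ ⊗ J_W)(𝔸)` through `Ad(a ⊗ 1)`**, Kronecker coordinates:
`p′ ↦ reindex_e⁻¹ (s ((a ⊗ 1) p′ (a ⊗ 1)⁻¹))`. [cite: Kudla1984, §1] -/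
def seesawPairConjLeft (s : adelicPair F E c N M JV JW →* adelicMpCont F (Fin n) (adelicGram F e TV TW))
    (a : GL (Fin N) (AdeleRing (𝓞 E) E))
    (ha : ((a : Matrix (Fin N) (Fin N) (AdeleRing (𝓞 E) E)).map (conjAdele F E c))ᵀ * adelicForm E N JV * a =
      adelicForm E N JV') :
    adelicPair F E c N M JV' JW →*
      adelicMpCont F (Fin N × Fin M)
        (TV.map (algebraMap F (AdeleRing (𝓞 F) F)) ⊗ₖ TW.map (algebraMap F (AdeleRing (𝓞 F) F))) :=
  ((adelicMpContReindex F e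
      (TV.map (algebraMap F (AdeleRing (𝓞 F) F)) ⊗ₖ TW.map (algebraMap F (AdeleRing (𝓞 F) F)))).symm.toMonoidHom.comp
    s).comp (adelicPairIsometryConjLeft F E c N M a ha)

/-- Unfolding. [cite: Weil1964, Chap. III n° 40 p. 190] -/
theorem seesawPairConjLeft_apply (s : adelicPair F E c N M JV JW →* adelicMpCont F (Fin n) (adelicGram F e TV TW))
    (a : GL (Fin N) (AdeleRing (𝓞 E) E))
    (ha : ((a : Matrix (Fin N) (Fin N) (AdeleRing (𝓞 E) E)).map (conjAdele F E c))ᵀ * adelicForm E N JV * a =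
      adelicForm E N JV') (p : adelicPair F E c N M JV' JW) :
    seesawPairConjLeft F E c N M e JV JV' JW s a ha p =
      (adelicMpContReindex F e
        (TV.map (algebraMap F (AdeleRing (𝓞 F) F)) ⊗ₖ TW.map (algebraMap F (AdeleRing (𝓞 F) F)))).symm
        (s (adelicPairIsometryConjLeft F E c N M a ha p)) :=
  rfl

/-- `ω(seesawPairConjLeft s a ha p′) Φ = R_e⁻¹ (ω(s ((a ⊗ 1) p′ (a ⊗ 1)⁻¹)) (R_e Φ))`. [cite: MoeglinVignerasWaldspurger1987, Chap. 2 II.1] -/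
theorem omega_seesawPairConjLeft_apply
    (s : adelicPair F E c N M JV JW →* adelicMpCont F (Fin n) (adelicGram F e TV TW))
    (a : GL (Fin N) (AdeleRing (𝓞 E) E))
    (ha : ((a : Matrix (Fin N) (Fin N) (AdeleRing (𝓞 E) E)).map (conjAdele F E c))ᵀ * adelicForm E N JV * a =
      adelicForm E N JV') (p : adelicPair F E c N M JV' JW) (Φ : piSchwartzBruhat F (Fin N × Fin M)) :
    adelicMpCont.omega F (Fin N × Fin M)
        (TV.map (algebraMap F (AdeleRing (𝓞 F) F)) ⊗ₖ TW.map (algebraMap F (AdeleRing (𝓞 F) F)))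
        (seesawPairConjLeft F E c N M e JV JV' JW s a ha p) Φ =
      (piSBReindex F e).symm
        (adelicMpCont.omega F (Fin n) (adelicGram F e TV TW) (s (adelicPairIsometryConjLeft F E c N M a ha p))
          (piSBReindex F e Φ)) :=
  adelicMpCont.omega_reindex_symm_apply F e _ _ Φ

variable [Algebra.IsQuadraticExtension F E] {δ : E} (hcδ : c δ = -δ) (hδ : δ ≠ 0) {d : F}
  (hd : δ * δ = algebraMap F E d) (hV : TV.IsSymm) (hV' : TV'.IsSymm) (hW : TW.IsSymm)
  (hVd : IsUnit TV.det) (hV'd : IsUnit TV'.det) (hWd : IsUnit TW.det)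
  (hT : IsUnit (TV.map (algebraMap F (AdeleRing (𝓞 F) F)) ⊗ₖ TW.map (algebraMap F (AdeleRing (𝓞 F) F))).det)
  (hJV : JV = TV.map (algebraMap F E)) (hJV' : JV' = TV'.map (algebraMap F E)) (hJW : JW = TW.map (algebraMap F E))
  {s : adelicPair F E c N M JV JW →* adelicMpCont F (Fin n) (adelicGram F e TV TW)}
  {a : GL (Fin N) (AdeleRing (𝓞 E) E)} {a₀ : GL (Fin N) E}
  (haa₀ : (a : Matrix (Fin N) (Fin N) (AdeleRing (𝓞 E) E)) =
    ((a₀ : GL (Fin N) E) : Matrix (Fin N) (Fin N) E).map (algebraMap E (AdeleRing (𝓞 E) E)))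
  (ha : ((a : Matrix (Fin N) (Fin N) (AdeleRing (𝓞 E) E)).map (conjAdele F E c))ᵀ * adelicForm E N JV * a =
    adelicForm E N JV')
  {C : GL (Fin N × Fin M) (AdeleRing (𝓞 F) F)} {C₀ : GL (Fin N × Fin M) F}
  (hCC₀ : (C : Matrix (Fin N × Fin M) (Fin N × Fin M) (AdeleRing (𝓞 F) F)) =
    ((C₀ : GL (Fin N × Fin M) F) : Matrix (Fin N × Fin M) (Fin N × Fin M) F).map (algebraMap F (AdeleRing (𝓞 F) F)))
  (hC : TV.map (algebraMap F (AdeleRing (𝓞 F) F)) ⊗ₖ TW.map (algebraMap F (AdeleRing (𝓞 F) F)) *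
      (C : Matrix (Fin N × Fin M) (Fin N × Fin M) (AdeleRing (𝓞 F) F)) =
    TV'.map (algebraMap F (AdeleRing (𝓞 F) F)) ⊗ₖ TW.map (algebraMap F (AdeleRing (𝓞 F) F)))

/-- **`π(seesawPairConjLeft s a ha p′) = ι_{V,W}((a ⊗ 1) p′ (a ⊗ 1)⁻¹)`** for a compatible `s`. [cite: GelbartRogawski1991, §3.1 Prop. 3.1.1 p. 455 L1–3] -/
theorem proj_seesawPairConjLeft (hs : (splittingDatum F E c N M e JV JW hcδ hδ hd hV hW hVd hWd hJV hJW).IsCompatible s)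
    (p : adelicPair F E c N M JV' JW) :
    adelicMpCont.proj F (Fin N × Fin M)
        (TV.map (algebraMap F (AdeleRing (𝓞 F) F)) ⊗ₖ TW.map (algebraMap F (AdeleRing (𝓞 F) F)))
        (seesawPairConjLeft F E c N M e JV JV' JW s a ha p) =
      adelicPairToSymplectic F E c N M hcδ hδ hd hV hW hJV hJW (adelicPairIsometryConjLeft F E c N M a ha p) :=
  adelicMpCont.proj_reindex_symm_eq F e _ (hs.1 (adelicPairIsometryConjLeft F E c N M a ha p))

include haa₀ in
/-- **`Θ`-fixing at rational points** for the splitting read through `Ad(a ⊗ 1)`, `a = a₀ ⊗ 1` rational.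
[cite: Weil1964, Chap. III n° 41 Thm 6 p. 193] -/
theorem coe_seesawPairConjLeft_mem_adelicMpTheta
    (hs : (splittingDatum F E c N M e JV JW hcδ hδ hd hV hW hVd hWd hJV hJW).IsCompatible s)
    (ha₀ : (((a₀ : GL (Fin N) E) : Matrix (Fin N) (Fin N) E).map (c : E →+* E))ᵀ * JV * a₀ = JV')
    {p : adelicPair F E c N M JV' JW} (hp : p ∈ (rationalPairToAdelic F E c N M JV' JW).range) :
    ((seesawPairConjLeft F E c N M e JV JV' JW s a ha p :
        adelicMpCont F (Fin N × Fin M)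
          (TV.map (algebraMap F (AdeleRing (𝓞 F) F)) ⊗ₖ TW.map (algebraMap F (AdeleRing (𝓞 F) F)))) :
        adelicMp F (Fin N × Fin M)
          (TV.map (algebraMap F (AdeleRing (𝓞 F) F)) ⊗ₖ TW.map (algebraMap F (AdeleRing (𝓞 F) F)))) ∈
      adelicMpTheta F (Fin N × Fin M)
        (TV.map (algebraMap F (AdeleRing (𝓞 F) F)) ⊗ₖ TW.map (algebraMap F (AdeleRing (𝓞 F) F))) := by
  refine (coe_adelicMpContReindex_symm_mem_adelicMpTheta_iff F e _ _).2 ?_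
  have hmemPts : adelicPairIsometryConjLeft F E c N M a ha p ∈
      (splittingDatum F E c N M e JV JW hcδ hδ hd hV hW hVd hWd hJV hJW).ratPts :=
    adelicPairIsometryConjLeft_mem_range F E c N M a ha a₀ ha₀ haa₀ hp
  obtain ⟨x, hx⟩ := hs.2 _ hmemPts
  have hθ := omega_ratSplit_mem_thetaStabilizer F E c N M e JV JW hcδ hδ hd hV hW hVd hWd hJV hJW x
  have hθ' : (adelicMpCont.omega F (Fin n) (adelicGram F e TV TW)).toHomUnits
      (s (adelicPairIsometryConjLeft F E c N M a ha p)) ∈ thetaStabilizer F (Fin n) :=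
    (congrArg (fun q => (adelicMpCont.omega F (Fin n) (adelicGram F e TV TW)).toHomUnits q ∈ thetaStabilizer F (Fin n))
      hx).mp hθ
  refine (mem_adelicMpTheta_iff _).2 fun Φ => ?_
  have h := (mem_thetaStabilizer_iff _).1 hθ' Φ
  simpa only [thetaDistLM_apply, MonoidHom.coe_toHomUnits, adelicMpCont.omega_apply, omegaPsi_apply, MpPsi.toOp_apply,
    LinearEquiv.smul_def] using h

/-- **the see-saw element of this data** (reducible abbreviation of `adelicSeesawConjLeft`). [cite: Kudla1984, §1] -/
abbrev seesawElementLeft :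
    symplecticGroup (polar (adelicForm F (Fin N × Fin M)
      (TV.map (algebraMap F (AdeleRing (𝓞 F) F)) ⊗ₖ TW.map (algebraMap F (AdeleRing (𝓞 F) F))))) :=
  adelicSeesawConjLeft F E c N M hcδ hδ hd hV hV' hW hJV hJV' hJW a ha C hC

include hVd hWd haa₀ hCC₀ in
/-- the see-saw element of rational data is `F`-rational (`adelicSeesawConjLeft_mem_range`). [cite: GelbartRogawski1991, §3.1 p. 455] -/
theorem seesawElementLeft_mem_range :
    seesawElementLeft F E c N M JV JV' JW hcδ hδ hd hV hV' hW hJV hJV' hJW ha hC ∈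
      ((transportSp (TV.map (algebraMap F (AdeleRing (𝓞 F) F)) ⊗ₖ TW.map (algebraMap F (AdeleRing (𝓞 F) F))) hT).comp
        (mapHom (algebraMap F (AdeleRing (𝓞 F) F)))).range :=
  adelicSeesawConjLeft_mem_range F E c N M hcδ hδ hd hV hV' hW hVd hWd hT hJV hJV' hJW haa₀ ha hCC₀ hC

include hVd hWd hT haa₀ hCC₀ in
/-- **THE SPLITTING CONJUGATED BY WEIL'S RATIONAL LIFT OF THE SEE-SAW ELEMENT AND RELABELLED**:
`ratConjSplitting … h₀ hrat C hC (seesawPairConjLeft s a ha) : U(J_V′ ⊗ J_W)(𝔸) →* Mp_ψ(W_{T_V′ ⊗ T_W})ᶜᵒⁿᵗ`.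
[cite: Weil1964, Chap. III n° 40 p. 190] -/
def seesawConjSplittingLeft :
    adelicPair F E c N M JV' JW →*
      adelicMpCont F (Fin N × Fin M)
        (TV'.map (algebraMap F (AdeleRing (𝓞 F) F)) ⊗ₖ TW.map (algebraMap F (AdeleRing (𝓞 F) F))) :=
  ratConjSplitting F (Fin N × Fin M) hT
    (seesawElementLeft F E c N M JV JV' JW hcδ hδ hd hV hV' hW hJV hJV' hJW ha hC)
    (seesawElementLeft_mem_range F E c N M JV JV' JW hcδ hδ hd hV hV' hW hVd hWd hT hJV hJV' hJW haa₀ ha hCC₀ hC)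
    C hC (seesawPairConjLeft F E c N M e JV JV' JW s a ha)

/-- Unfolding. [cite: Weil1964, Chap. III n° 40 p. 190] -/
theorem seesawConjSplittingLeft_def :
    seesawConjSplittingLeft F E c N M e JV JV' JW hcδ hδ hd hV hV' hW hVd hWd hT hJV hJV' hJW haa₀ ha hCC₀ hC (s := s) =
      ratConjSplitting F (Fin N × Fin M) hT
        (seesawElementLeft F E c N M JV JV' JW hcδ hδ hd hV hV' hW hJV hJV' hJW ha hC)
        (seesawElementLeft_mem_range F E c N M JV JV' JW hcδ hδ hd hV hV' hW hVd hWd hT hJV hJV' hJW haa₀ ha hCC₀ hC)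
        C hC (seesawPairConjLeft F E c N M e JV JV' JW s a ha) :=
  rfl

/-- **the square feeding the seam lemma** (`relabelVec` currency): `h₀ · Congr_{Λ_C}(ι_{V′,W}(p′)) · h₀⁻¹ = π(seesawPairConjLeft s a ha p′)`.
[cite: Kudla1984, §1] -/
theorem hsq_seesawConjLeft
    (hs : (splittingDatum F E c N M e JV JW hcδ hδ hd hV hW hVd hWd hJV hJW).IsCompatible s)
    (q : adelicPair F E c N M JV' JW) :
    seesawElementLeft F E c N M JV JV' JW hcδ hδ hd hV hV' hW hJV hJV' hJW ha hC *
        symplecticGroupCongr _ _ (relabelVec F (Fin N × Fin M) C) (polar_relabelVec F (Fin N × Fin M) C hC)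
          (adelicPairToSymplectic F E c N M hcδ hδ hd hV' hW hJV' hJW q) *
      (seesawElementLeft F E c N M JV JV' JW hcδ hδ hd hV hV' hW hJV hJV' hJW ha hC)⁻¹ =
    adelicMpCont.proj F (Fin N × Fin M)
      (TV.map (algebraMap F (AdeleRing (𝓞 F) F)) ⊗ₖ TW.map (algebraMap F (AdeleRing (𝓞 F) F)))
      (seesawPairConjLeft F E c N M e JV JV' JW s a ha q) :=
  (adelicSeesawConjLeft_conj_pair F E c N M hcδ hδ hd hV hV' hW hJV hJV' hJW a ha C hC q).trans
    (proj_seesawPairConjLeft F E c N M e JV JV' JW hcδ hδ hd hV hW hVd hWd hJV hJW ha hs q).symm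

/-- **`π(seesawConjSplittingLeft p′) = ι_{V′,W}(p′)`** — `proj_ratConjSplitting_eq` fed with `hsq_seesawConjLeft`.
[cite: Kudla1984, §1] -/
theorem proj_seesawConjSplittingLeft
    (hs : (splittingDatum F E c N M e JV JW hcδ hδ hd hV hW hVd hWd hJV hJW).IsCompatible s)
    (p : adelicPair F E c N M JV' JW) :
    adelicMpCont.proj F (Fin N × Fin M)
        (TV'.map (algebraMap F (AdeleRing (𝓞 F) F)) ⊗ₖ TW.map (algebraMap F (AdeleRing (𝓞 F) F)))
        (seesawConjSplittingLeft F E c N M e JV JV' JW hcδ hδ hd hV hV' hW hVd hWd hT hJV hJV' hJW haa₀ ha hCC₀ hC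
          (s := s) p) =
      adelicPairToSymplectic F E c N M hcδ hδ hd hV' hW hJV' hJW p :=
  proj_ratConjSplitting_eq F (Fin N × Fin M) hT
    (seesawElementLeft F E c N M JV JV' JW hcδ hδ hd hV hV' hW hJV hJV' hJW ha hC)
    (seesawElementLeft_mem_range F E c N M JV JV' JW hcδ hδ hd hV hV' hW hVd hWd hT hJV hJV' hJW haa₀ ha hCC₀ hC)
    C hC (seesawPairConjLeft F E c N M e JV JV' JW s a ha)
    (fun q => adelicPairToSymplectic F E c N M hcδ hδ hd hV' hW hJV' hJW q)
    (hsq_seesawConjLeft F E c N M e JV JV' JW hcδ hδ hd hV hV' hW hVd hWd hJV hJV' hJW ha hC hs) p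

/-- **`Θ`-fixing at rational points** for the conjugated splitting (`r_F(h₀)` is `Θ`-fixing).
[cite: Weil1964, Chap. III n° 41 Thm 6 p. 193] -/
theorem coe_seesawConjSplittingLeft_mem_adelicMpTheta
    (hs : (splittingDatum F E c N M e JV JW hcδ hδ hd hV hW hVd hWd hJV hJW).IsCompatible s)
    (ha₀ : (((a₀ : GL (Fin N) E) : Matrix (Fin N) (Fin N) E).map (c : E →+* E))ᵀ * JV * a₀ = JV')
    {p : adelicPair F E c N M JV' JW} (hp : p ∈ (rationalPairToAdelic F E c N M JV' JW).range) :
    ((seesawConjSplittingLeft F E c N M e JV JV' JW hcδ hδ hd hV hV' hW hVd hWd hT hJV hJV' hJW haa₀ ha hCC₀ hC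
          (s := s) p :
        adelicMpCont F (Fin N × Fin M)
          (TV'.map (algebraMap F (AdeleRing (𝓞 F) F)) ⊗ₖ TW.map (algebraMap F (AdeleRing (𝓞 F) F)))) :
        adelicMp F (Fin N × Fin M)
          (TV'.map (algebraMap F (AdeleRing (𝓞 F) F)) ⊗ₖ TW.map (algebraMap F (AdeleRing (𝓞 F) F)))) ∈
      adelicMpTheta F (Fin N × Fin M)
        (TV'.map (algebraMap F (AdeleRing (𝓞 F) F)) ⊗ₖ TW.map (algebraMap F (AdeleRing (𝓞 F) F))) :=
  (coe_ratConjSplitting_mem_adelicMpTheta_iff F (Fin N × Fin M) hT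
      (seesawElementLeft F E c N M JV JV' JW hcδ hδ hd hV hV' hW hJV hJV' hJW ha hC)
      (seesawElementLeft_mem_range F E c N M JV JV' JW hcδ hδ hd hV hV' hW hVd hWd hT hJV hJV' hJW haa₀ ha hCC₀ hC)
      C hC (seesawPairConjLeft F E c N M e JV JV' JW s a ha) _).2
    (coe_seesawPairConjLeft_mem_adelicMpTheta F E c N M e JV JV' JW hcδ hδ hd hV hW hVd hWd hJV hJW haa₀ ha hs ha₀ hp)

end Transport

end UnitaryDualPair

end Literature.NumberTheory.GelbartRogawski1991

end
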